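import Summits.Schanuel.Schanuel.Theorems.DiophantineDichotomyApproximationPropertyRaceUpTo
import Literature.NumberTheory.Transcendental.EclWeakSchanuelProofs
import HarnessLib

/-!
# Schanuel's conjecture for `n ≤ 3` from the approximation-measure crux ALONE (crux `ApproximationProperty`, stmt-Schanuel-6117, is discharged up to `n = 3`)

Route `DiophantineDichotomy` (sub-problem `Schanuel/Schanuel`). The route decides Schanuel's conjecture
from two ranked cruxes — Philippon's approximation property in every transcendence degree
(`ApproximationProperty`, crux 3, stmt-Schanuel-6117; OPEN for `t ≥ 3`) and the eventual
simultaneous-approximation measure at free Khovanskii points (`KhovanskiiApproxTypeEv`, crux 2) — via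
the PROVED reduction `KhovanskiiReduction` (Kirby / Ax). Both the race (`closes`) and the reduction
(`card_le_trdeg_of_khovanskiiSchanuel`, strong induction on `n` that only DESCENDS) respect the level
`n`, and crux 3 enters level `n` only through its slice `t = n − 1`, whose cases `t ≤ 2` are LANDED
(`slice_one`, `slice_two`). This file draws the consequence (line lead
`prover-line-stmt-Schanuel-6117-c11-0`; registered sub-goals of the crux item; proofs only):

* `card_le_trdeg_upTo_of_khovanskiiSchanuel_upTo` — the Kirby–Ax reduction LEVEL BY LEVEL: Schanuel at
  free Khovanskii points for all `n ≤ N` implies Schanuel's conjecture for all `n ≤ N` (the proof of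
  `card_le_trdeg_of_khovanskiiSchanuel`, verbatim, with the bound `n ≤ N` carried through the descent).
* `schanuel_le_three_of_khovanskiiApproxTypeEv` — **`KhovanskiiApproxTypeEv` ALONE implies Schanuel's
  conjecture for every `ℚ`-linearly independent `x̄ ∈ ℂⁿ` with `n ≤ 3`** (so, e.g., the algebraic
  independence of `e` and `π`, of `log 2` and `log 3`, of `π` and `e^π`… would all follow from crux 2 at
  `n ≤ 3`): crux 3 contributes nothing open below `n = 4`.
* `schanuel_le_four_of_slice_three` — with the `t = 3` slice of crux 3 (conditional in the tree on the
  far deficient satellite kernel, p140489) the same holds for `n ≤ 4`.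

Sources: Kirby 2010 (Prop. 7.1/7.2), Ax 1971 (Thm. 3) — as in `…KhovanskiiReduction.lean`;
`…ApproximationPropertyRaceUpTo.lean` (c11); NesterenkoPhilippon2001 Ch. 4 §4.
-/

noncomputable section

-- `Summit.Schanuel.Schanuel.…` is the mandated summit/sub-problem namespace (single-conjunct summit), hence:
set_option linter.dupNamespace false

open Cardinal MvPolynomial
open Literature.NumberTheory.Transcendental

namespace Summit.Schanuel.Schanuel.Cruxes.ApproximationProperty.Race

open Summit.Schanuel.Schanuel.Theses.DiophantineDichotomy
open Summit.Schanuel.Schanuel.Cruxes.ApproximationProperty.OrbitInterpolationDeterminant (PointwiseAPSlice)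

/-- **Registered sub-goal `card_le_trdeg_upTo_of_khovanskiiSchanuel_upTo`** — the Kirby–Ax reduction
level by level: if every `ℚ`-linearly independent non-degenerate solution `s ∈ ℂⁿ` of a Khovanskii
system with `n ≤ N` has `trdeg_ℚ ℚ(s, e^s) ≥ n`, then every `ℚ`-linearly independent `x̄ ∈ ℂⁿ` with
`n ≤ N` has `trdeg_ℚ ℚ(x̄, e^{x̄}) ≥ n`. Proof: verbatim `card_le_trdeg_of_khovanskiiSchanuel`
(strong induction on `n` inside `L = ℚ(x̄, e^{x̄})`; Khovanskii dichotomy: (a) free Khovanskii point ⇒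
hypothesis at level `n ≤ N`; (b) a non-zero E-derivation splits `n = m + n'`, `m < n`, induction at
level `m ≤ N` for an integral basis `z̄` of the dependence space, Ax's theorem with rank term for the
rest, tower law) with the bound `n ≤ N` carried along. [cite: Kirby2010, Prop. 7.1, Prop. 7.2 and p. 11] -/
theorem card_le_trdeg_upTo_of_khovanskiiSchanuel_upTo :
    ∀ N : ℕ, (∀ (n : ℕ) (s : Fin n → ℂ), n ≤ N → LinearIndependent ℚ s →
      (∃ g : Fin n → MvPolynomial (Fin n ⊕ Fin n) ℚ, (∀ i, MvPolynomial.aeval (Sum.elim s (Complex.exp ∘ s)) (g i) = 0) ∧ (Matrix.of fun i j => MvPolynomial.aeval (Sum.elim s (Complex.exp ∘ s)) (MvPolynomial.pderiv (Sum.inl j) (g i) + MvPolynomial.X (Sum.inr j) * MvPolynomial.pderiv (Sum.inr j) (g i))).det ≠ 0) →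
      (n : Cardinal) ≤ Algebra.trdeg ℚ
        ↥(IntermediateField.adjoin ℚ (Set.range s ∪ Set.range (Complex.exp ∘ s)))) →
    ∀ (n : ℕ) (x : Fin n → ℂ), n ≤ N → LinearIndependent ℚ x →
      (n : Cardinal) ≤ Algebra.trdeg ℚ
        ↥(IntermediateField.adjoin ℚ (Set.range x ∪ Set.range (Complex.exp ∘ x))) := by
  intro N hX n
  induction n using Nat.strong_induction_on with
  | _ n ih =>
  intro x hnN hx
  classical
  rcases Nat.eq_zero_or_pos n with rfl | hn
  · simp
  -- the field `L = ℚ(x̄, e^{x̄})`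
  set S : Set ℂ := Set.range x ∪ Set.range (Complex.exp ∘ x) with hS
  set L : IntermediateField ℚ ℂ := IntermediateField.adjoin ℚ S with hL
  have hxS : ∀ i, x i ∈ L := fun i => IntermediateField.subset_adjoin ℚ S (Or.inl ⟨i, rfl⟩)
  have hyS : ∀ i, Complex.exp (x i) ∈ L := fun i =>
    IntermediateField.subset_adjoin ℚ S (Or.inr ⟨i, rfl⟩)
  set xL : Fin n → L := fun i => ⟨x i, hxS i⟩ with hxL
  set yL : Fin n → L := fun i => ⟨Complex.exp (x i), hyS i⟩ with hyL
  have hy0 : ∀ i, yL i ≠ 0 := fun i h => Complex.exp_ne_zero (x i) (congrArg Subtype.val h)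
  have htopL : IntermediateField.adjoin ℚ (Set.range xL ∪ Set.range yL) = ⊤ := by
    have h := IntermediateField.adjoin_preimage_val_eq_top (F := ℚ) S
    have hpre : Set.range xL ∪ Set.range yL = ((↑) : L → ℂ) ⁻¹' S := by
      ext t
      simp only [Set.mem_union, Set.mem_range, Set.mem_preimage, hS, Function.comp_apply]
      constructor
      · rintro (⟨i, rfl⟩ | ⟨i, rfl⟩)
        · exact Or.inl ⟨i, rfl⟩
        · exact Or.inr ⟨i, rfl⟩
      · rintro (⟨i, hi⟩ | ⟨i, hi⟩)
        · exact Or.inl ⟨i, Subtype.ext hi⟩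
        · exact Or.inr ⟨i, Subtype.ext hi⟩
    rw [hpre]
    exact h
  set zL : Fin n ⊕ Fin n → L := Sum.elim xL yL with hzL
  rcases khovanskii_dichotomy xL yL htopL with ⟨g, hg0, hdet⟩ | ⟨D, hDE, j₀, hj₀⟩
  · /- (a) `x̄` is a free Khovanskii point: the hypothesis `X` applies -/
    simp only [← hzL] at hg0 hdet
    have hpt : Sum.elim x (Complex.exp ∘ x) = algebraMap L ℂ ∘ zL := by
      funext s; rcases s with i | i <;> rfl
    have heval : ∀ p : MvPolynomial (Fin n ⊕ Fin n) ℚ,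
        aeval (Sum.elim x (Complex.exp ∘ x)) p = algebraMap L ℂ (aeval zL p) := by
      intro p
      rw [hpt, aeval_algebraMap_apply]
    refine hX n x hnN hx ⟨g, fun i => ?_, ?_⟩
    · rw [heval, hg0 i, map_zero]
    · have hJ : (Matrix.of fun i j => aeval (Sum.elim x (Complex.exp ∘ x))
          (pderiv (Sum.inl j) (g i) + X (Sum.inr j) * pderiv (Sum.inr j) (g i))) =
          (algebraMap L ℂ).mapMatrix
            (Matrix.of fun i j => aeval zL (Khovanskii.ePD j (g i))) := by
        ext i j
        simp only [Matrix.of_apply, RingHom.mapMatrix_apply, Matrix.map_apply]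
        rw [← heval]
        rfl
      rw [hJ, ← RingHom.map_det, map_ne_zero]
      exact hdet
  · /- (b) a non-zero E-derivation `D` of `L` over `ℚ` -/
    -- `D` as a `ℤ`-derivation, its constants `CD`
    set Dz : Derivation ℤ L L := D.restrictScalars ℤ with hDz
    set D1 : Fin 1 → Derivation ℤ L L := fun _ => Dz with hD1
    set CD : Subring L := constantSubring D1 with hCD
    have hmemCD : ∀ a : L, a ∈ CD ↔ D a = 0 := fun a => by
      simp only [hCD, hD1, hDz, mem_constantSubring, forall_const]
      exact Iff.rfl
    have hFCD : ∀ c : ℚ, algebraMap ℚ L c ∈ CD := fun c => (hmemCD _).mpr (D.map_algebraMap c)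
    -- the elements of `L` killed by `D`, as a `ℚ`-subspace `N` of `ℂ`
    set N : Submodule ℚ ℂ :=
      (LinearMap.ker (D : L →ₗ[ℚ] L)).map (IsScalarTower.toAlgHom ℚ L ℂ).toLinearMap with hN
    have hmemN : ∀ a : ℂ, a ∈ N ↔ ∃ l : L, D l = 0 ∧ (l : ℂ) = a := fun a => by
      simp only [hN, Submodule.mem_map, LinearMap.mem_ker]
      constructor
      · rintro ⟨l, hl, rfl⟩; exact ⟨l, hl, rfl⟩
      · rintro ⟨l, hl, rfl⟩; exact ⟨l, hl, rfl⟩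
    -- the dependence space `V = {q ∈ ℚⁿ | q·x̄ ∈ N}` and the splitting `n = n' + m`
    set T : (Fin n → ℚ) →ₗ[ℚ] ℂ := Fintype.linearCombination ℚ x with hT
    have hTapply : ∀ v : Fin n → ℚ, T v = ∑ i, v i • x i := fun v =>
      Fintype.linearCombination_apply ℚ x v
    set V : Submodule ℚ (Fin n → ℚ) := N.comap T with hV
    set T' : (Fin n → ℚ) →ₗ[ℚ] ℂ ⧸ N := N.mkQ ∘ₗ T with hT'
    have hker : LinearMap.ker T' = V := by rw [hT', LinearMap.ker_comp, Submodule.ker_mkQ]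
    obtain ⟨κ, a, ha, hspan, hli⟩ := exists_linearIndependent' ℚ ((Submodule.mkQ N) ∘ x)
    haveI : Fintype κ := Fintype.ofInjective a ha
    set n' := Fintype.card κ with hn'
    set e := Fintype.equivFin κ with he
    have hrange : Module.finrank ℚ (LinearMap.range T') = n' := by
      have h1 : LinearMap.range T' = Submodule.span ℚ (Set.range (N.mkQ ∘ x)) := by
        rw [hT', LinearMap.range_comp, hT, Fintype.range_linearCombination, Submodule.map_span,
          ← Set.range_comp]
      rw [h1, ← hspan, finrank_span_eq_card hli]
    set m := Module.finrank ℚ V with hm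
    have hnm : n' + m = n := by
      have := LinearMap.finrank_range_add_finrank_ker T'
      rwa [hrange, hker, Module.finrank_fin_fun] at this
    have hmn : m < n := by
      by_contra hmn'
      have hmn2 : m = n := le_antisymm (by omega) (not_lt.mp hmn')
      have hVtop : V = ⊤ :=
        Submodule.eq_top_of_finrank_eq (by rw [← hm, hmn2, Module.finrank_fin_fun])
      have hmemV : (Pi.single j₀ (1 : ℚ) : Fin n → ℚ) ∈ V := hVtop ▸ Submodule.mem_top
      rw [hV, Submodule.mem_comap, hT, Fintype.linearCombination_apply_single, one_smul] at hmemV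
      obtain ⟨l, hl0, hl⟩ := (hmemN _).mp hmemV
      have hlx : l = xL j₀ := Subtype.ext hl
      rw [hlx] at hl0
      exact hj₀ hl0
    -- Ax's theorem for a maximal sub-tuple `x̄'` of `x̄` independent modulo `N`
    set x' : Fin n' → L := fun i => xL (a (e.symm i)) with hx'
    set y' : Fin n' → L := fun i => yL (a (e.symm i)) with hy'
    have hind : IsQLinearIndependentMod D1 x' := by
      intro q hq
      have hD0 : D (∑ i, (q i : L) * x' i) = 0 := (hmemCD _).mp hq
      have hNmem : (∑ i, ((q i : ℚ)) • x (a (e.symm i))) ∈ N := by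
        refine (hmemN _).mpr ⟨_, hD0, ?_⟩
        rw [show (∑ i, ((q i : ℚ)) • x (a (e.symm i))) = ∑ i, (q i : ℂ) * x (a (e.symm i)) from
          Finset.sum_congr rfl fun i _ => by rw [Rat.smul_def, Rat.cast_intCast]]
        push_cast
        simp only [hx', hxL]
      have h0 : ∑ i, ((q i : ℤ) : ℚ) • ((N.mkQ ∘ x ∘ a) ∘ e.symm) i = 0 := by
        have h1 : N.mkQ (∑ i, ((q i : ℚ)) • x (a (e.symm i))) = 0 :=
          (Submodule.Quotient.mk_eq_zero N).mpr hNmem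
        rw [map_sum] at h1
        simpa only [map_smul, Function.comp_apply] using h1
      have hli' : LinearIndependent ℚ ((N.mkQ ∘ x ∘ a) ∘ e.symm) :=
        hli.comp e.symm e.symm.injective
      have h2 := Fintype.linearIndependent_iff.mp hli' _ h0
      funext i
      exact_mod_cast h2 i
    have hAxL' := Ax1971.add_rank_le_trdeg D1 x' y' (fun i => hy0 _)
      (fun _ i => hDE (a (e.symm i))) hind
    have hAxL := le_trans (Nat.cast_le.mpr (Nat.le_add_right n' _)) hAxL'
    letI algCD : Algebra CD L := Algebra.ofSubsemiring CD
    have h1 : (n' : Cardinal) ≤ Algebra.trdeg CD L :=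
      hAxL.trans (trdeg_le_of_injective (Subalgebra.val _) Subtype.val_injective)
    -- an integral basis of `V` and the tuple `z̄`
    haveI hVfree : Module.Free ℚ V := Module.Free.of_divisionRing ℚ V
    haveI hVfin : FiniteDimensional ℚ V := FiniteDimensional.finiteDimensional_submodule V
    let bV := Module.finBasis ℚ V
    have hint : ∀ k : Fin m, ∃ d : ℕ, d ≠ 0 ∧ ∃ w : Fin n → ℤ,
        ∀ i, (d : ℚ) * ((bV k : V) : Fin n → ℚ) i = w i := fun k => exists_nat_mul_eq_intCast _
    choose d hd w hw using hint
    have huV : ∀ k, (fun i => (w k i : ℚ)) ∈ V := fun k => by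
      have : (fun i => (w k i : ℚ)) = (d k : ℚ) • ((bV k : V) : Fin n → ℚ) := by
        funext i; rw [Pi.smul_apply, smul_eq_mul, hw]
      rw [this]
      exact V.smul_mem _ (bV k).2
    have hli_u : LinearIndependent ℚ (fun k => fun i => (w k i : ℚ)) := by
      have hb : LinearIndependent ℚ (fun k => ((bV k : V) : Fin n → ℚ)) :=
        bV.linearIndependent.map' V.subtype (Submodule.ker_subtype V)
      have hb2 := hb.units_smul fun k => Units.mk0 (d k : ℚ) (Nat.cast_ne_zero.mpr (hd k))
      convert hb2 using 1
      funext k i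
      change (w k i : ℚ) = ((Units.mk0 (d k : ℚ) (Nat.cast_ne_zero.mpr (hd k))) •
        ((bV k : V) : Fin n → ℚ)) i
      rw [Units.smul_def, Units.val_mk0, Pi.smul_apply, smul_eq_mul, hw]
    set z : Fin m → ℂ := fun k => ∑ i, (w k i : ℂ) * x i with hz
    -- `z̄` is `ℚ`-linearly independent
    have hzind : LinearIndependent ℚ z := by
      rw [Fintype.linearIndependent_iff]
      intro c hc
      have hc1 : ∑ i, (∑ k, c k * (w k i : ℚ)) • x i = 0 := by
        rw [← hc]
        simp only [hz, Finset.smul_sum, Finset.sum_smul, mul_smul]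
        rw [Finset.sum_comm]
        refine Finset.sum_congr rfl fun k _ => Finset.sum_congr rfl fun i _ => ?_
        rw [Rat.smul_def (w k i : ℚ), Rat.cast_intCast]
      have hc2 := Fintype.linearIndependent_iff.mp hx _ hc1
      have hc3 : ∑ k, c k • (fun i => (w k i : ℚ)) = 0 := by
        funext i
        rw [Finset.sum_apply, Pi.zero_apply]
        simpa only [Pi.smul_apply, smul_eq_mul] using hc2 i
      exact Fintype.linearIndependent_iff.mp hli_u c hc3
    -- `z_k ∈ L` and `e^{z_k} ∈ L` are killed by `D`
    set zLk : Fin m → L := fun k => ∑ i, (w k i : L) * xL i with hzLk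
    have hzcoe : ∀ k, ((zLk k : L) : ℂ) = z k := fun k => by
      simp only [hzLk, hz, hxL]
      push_cast
      rfl
    have hDz0 : ∀ k, D (zLk k) = 0 := fun k => by
      obtain ⟨l, hl0, hl⟩ := (hmemN _).mp (Submodule.mem_comap.mp (huV k))
      have hTz : T (fun i => (w k i : ℚ)) = z k := by
        rw [hTapply, hz]
        exact Finset.sum_congr rfl fun i _ => by rw [Rat.smul_def, Rat.cast_intCast]
      have hl' : l = zLk k := Subtype.ext (by rw [hl, hTz, hzcoe])
      rw [← hl']
      exact hl0
    set ezLk : Fin m → L := fun k => ∏ i, yL i ^ w k i with hezLk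
    have hezcoe : ∀ k, ((ezLk k : L) : ℂ) = Complex.exp (z k) := fun k => by
      rw [hz]
      dsimp only
      rw [Complex.exp_sum]
      simp only [Complex.exp_int_mul, hezLk, hyL]
      push_cast
      rfl
    have hDez0 : ∀ k, D (ezLk k) = 0 := fun k => by
      simp only [hezLk]
      rw [derivation_prod_zpow_of_exp D xL yL hy0 hDE (w k)]
      have : D (∑ i, (w k i : L) * xL i) = 0 := hDz0 k
      rw [this, mul_zero]
    -- induction hypothesis for `z̄`
    have hIH : (m : Cardinal) ≤ Algebra.trdeg ℚ
        ↥(IntermediateField.adjoin ℚ (Set.range z ∪ Set.range (Complex.exp ∘ z))) :=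
      ih m hmn z (by omega) hzind
    set Sz : Set ℂ := Set.range z ∪ Set.range (Complex.exp ∘ z) with hSz
    set Nz : IntermediateField ℚ ℂ := IntermediateField.adjoin ℚ Sz with hNz
    change (m : Cardinal) ≤ Algebra.trdeg ℚ Nz at hIH
    have hle : Nz ≤ L := by
      rw [hNz, IntermediateField.adjoin_le_iff]
      rintro t (⟨k, rfl⟩ | ⟨k, rfl⟩)
      · rw [← hzcoe]; exact (zLk k).2
      · simp only [Function.comp_apply]; rw [← hezcoe]; exact (ezLk k).2
    have hιE : ∀ (t : ℂ) (ht : t ∈ Nz), (⟨t, hle ht⟩ : L) ∈ CD := by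
      intro t ht
      rw [hmemCD]
      induction ht using IntermediateField.adjoin_induction with
      | mem t ht =>
        rcases ht with ⟨k, rfl⟩ | ⟨k, rfl⟩
        · have h' : (⟨z k, hle (IntermediateField.subset_adjoin ℚ Sz (Or.inl ⟨k, rfl⟩))⟩ : L) =
              zLk k := Subtype.ext (hzcoe k).symm
          rw [h']; exact hDz0 k
        · have h' : (⟨(Complex.exp ∘ z) k,
              hle (IntermediateField.subset_adjoin ℚ Sz (Or.inr ⟨k, rfl⟩))⟩ : L) = ezLk k :=
            Subtype.ext (hezcoe k).symm
          rw [h']; exact hDez0 k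
      | algebraMap c => exact D.map_algebraMap c
      | add s t hs ht ihs iht =>
        have h' : (⟨s + t, hle (add_mem hs ht)⟩ : L) = ⟨s, hle hs⟩ + ⟨t, hle ht⟩ := rfl
        rw [h', map_add, ihs, iht, add_zero]
      | inv s hs ihs =>
        have h' : (⟨s⁻¹, hle (inv_mem hs)⟩ : L) = (⟨s, hle hs⟩)⁻¹ := rfl
        rw [h', Derivation.leibniz_inv, ihs, smul_zero]
      | mul s t hs ht ihs iht =>
        have h' : (⟨s * t, hle (mul_mem hs ht)⟩ : L) = ⟨s, hle hs⟩ * ⟨t, hle ht⟩ := rfl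
        rw [h', Derivation.leibniz, ihs, iht, smul_zero, smul_zero, add_zero]
    -- assembling: `n = m + n' ≤ trdeg_ℚ Nz + trdeg_CD L ≤ trdeg_ℚ L`
    have htower := trdeg_add_le_of_le_subring L Nz hle CD hFCD hιE
    calc (n : Cardinal) = (m : Cardinal) + (n' : Cardinal) := by
          rw [← hnm, Nat.cast_add, add_comm]
      _ ≤ Algebra.trdeg ℚ Nz + Algebra.trdeg CD L := add_le_add hIH h1
      _ ≤ Algebra.trdeg ℚ L := htower

/-- **Registered sub-goal `schanuel_le_three_of_khovanskiiApproxTypeEv`** — SCHANUEL'S CONJECTURE FOR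
`n ≤ 3` FROM CRUX 2 ALONE: the eventual simultaneous-approximation measure `KhovanskiiApproxTypeEv` at
free Khovanskii points implies `trdeg_ℚ ℚ(x̄, e^{x̄}) ≥ n` for every `ℚ`-linearly independent `x̄ ∈ ℂⁿ`,
`n ≤ 3`. The approximation-property input of the race at `t = n − 1 ≤ 2` is the landed
`slice_one`/`slice_two` (`khovanskiiSchanuel_le_three`), and the reduction is
`card_le_trdeg_upTo_of_khovanskiiSchanuel_upTo 3`. Crux 3 (`ApproximationProperty`) is thus
DISCHARGED for the route below `n = 4`. [cite: Kirby2010, Prop. 7.2] -/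
theorem schanuel_le_three_of_khovanskiiApproxTypeEv :
    KhovanskiiApproxTypeEv → ∀ (n : ℕ) (x : Fin n → ℂ), n ≤ 3 → LinearIndependent ℚ x →
      (n : Cardinal) ≤ Algebra.trdeg ℚ
        ↥(IntermediateField.adjoin ℚ (Set.range x ∪ Set.range (Complex.exp ∘ x))) :=
  fun hEv => card_le_trdeg_upTo_of_khovanskiiSchanuel_upTo 3 (khovanskiiSchanuel_le_three hEv)

/-- **Registered sub-goal `schanuel_le_four_of_slice_three`** — with the `t = 3` slice of crux 3
(`PointwiseAPSlice 3`; in the tree conditional on the far deficient satellite kernel alone,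
`slice_three_of_farDef`, p140489) and crux 2, Schanuel's conjecture holds for all `n ≤ 4`.
[cite: Kirby2010, Prop. 7.2] -/
theorem schanuel_le_four_of_slice_three :
    PointwiseAPSlice 3 → KhovanskiiApproxTypeEv → ∀ (n : ℕ) (x : Fin n → ℂ), n ≤ 4 →
      LinearIndependent ℚ x →
      (n : Cardinal) ≤ Algebra.trdeg ℚ
        ↥(IntermediateField.adjoin ℚ (Set.range x ∪ Set.range (Complex.exp ∘ x))) :=
  fun h3 hEv => card_le_trdeg_upTo_of_khovanskiiSchanuel_upTo 4
    (khovanskiiSchanuel_le_four_of_slice_three h3 hEv)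

end Summit.Schanuel.Schanuel.Cruxes.ApproximationProperty.Race

end
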